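import Summits.ResolutionOfSingularities.ResolutionOfSingularities.Theorems.EquisingularLiftEquisingularLiftNatEquimultipleStrictTransform
import Summits.ResolutionOfSingularities.ResolutionOfSingularities.Theorems.EquisingularLiftEquisingularLiftNatCarrierDeltaFlat
import Mathlib.RingTheory.DiscreteValuationRing.Basic
import HarnessLib

/-!
# [OURS · L1 W4.5(b) · EL♮(3)] T-M1-FLAT: the proximity-lift strict transform is FLAT over the discrete valuation ring
# — the uniformizer is a nonzerodivisor modulo the strict-transform generator on every chart of the blow-up along the section

Support file of the crux chain w45b (cell `res-hironaka`, LADDER-RESOLUTION rung L, slot W4.5(b)), working crux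
**EL♮ = `Theses.EquisingularLift.EquisingularLiftNat`** (stmt-ResolutionOfSingularities-20038) and its `n = 3` child
`EquisingularLiftNatThree` (stmt-ResolutionOfSingularities-20148); registered stubs `stub_elnat_tcDeltaPointResolution` /
`stub_elnat_three_isolated_nontc` (skeleton v6, res-L1-w45b-lead-2), draft stub `stub_elnat_tcPlusPointResolution`
(TARGET-TCPLUS 1457ad81086910d2). OURS; NOT a statement of any manuscript; AI-written, weaker than expert review. Filed
`--supports stmt-ResolutionOfSingularities-20148 --as helper` by res-L1-w45b-stub-1 (object T-M1-FLAT, STATUS 2026-08-27T08:58Z),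
the second item of the «not covered» list of `…NatEquimultipleStrictTransform` (T-M1-EXACT, res-L1-w45b-stub-3): for the
proximity-lift / in-carrier centre `C := St_s V(G̃)` of res-L1-w45b-lead-2's DESIGN v6 (TC⁺) («`C` regular, O-FLAT, E1,
in-carrier») the clause **O-FLAT** at ring level, in the currency of res-type-100's F3a `flat_carrierDelta_subschemeι_comp` (p512232)
(Hartshorne III 9.7: over the DVR, flat = `ϖ`-torsion-free, checked stalkwise).

SETTING (as in `…NatEquimultipleStrictTransform`; any commutative ring `A`). `x = (x₁, …, x_r)` in `A`, `I = (x)` (the SECTION),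
`ϖ ∈ A` (the uniformizer), `B = A[I/xᵢ]`, `Ā = A/ϖ`, `x̄`, `Ī = (x̄)` (the POINT), `B̄ = Ā[Ī/x̄ᵢ]`, `θ : B → B̄` the reduction map
(`blowupAlgebraMap`; surjective with kernel `ϖB` when `x` is quasi-regular, `A/I` a domain and `ϖ ∉ I` — p510548).

* CORE (any ring `R`): `mem_span_singleton_of_mul_mem_of_isPrime` — if `ϖ` is a nonzerodivisor, `(ϖ)` is prime and `g ∉ (ϖ)`,
  then `ϖ·a ∈ (g) ⇒ a ∈ (g)`: **`ϖ` is a nonzerodivisor on `R/(g)`** (five lines, no Cohen–Macaulay input);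
* DVR: `moduleFlat_of_forall_smul_eq_zero` — over a discrete valuation ring a module on which the uniformizer acts injectively
  is FLAT (torsion-free over a PID; every non-zero element is `u·ϖⁿ`); `ringHomFlat_of_forall_mul_eq_zero` — the same for a
  ring map `O → T`;
* CHART: `algebraMap_mem_nonZeroDivisors_blowupAlgebra_of_mem` (`ϖ/1` is a nonzerodivisor of `B` if `ϖ` is one of `A`),
  `blowupAlgebraMap_algebraMap_uniformizer` (`θ(ϖ/1) = 0`), `notMem_span_uniformizer_of_blowupAlgebraMap_ne_zero`
  (`θ g ≠ 0 ⇒ g ∉ ϖB`), `isPrime_span_algebraMap_uniformizer` (`ϖB = ker θ` is PRIME when `Ā` is a domain and `xᵢ ∉ ϖA`: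
  `B̄ ⊆ Ā[1/x̄ᵢ]` is a domain);
* **`mem_span_of_uniformizer_mul_mem`** — for ANY `g ∈ B` whose reduction `θ g` is non-zero (the special fibre of `V(g)` has no
  component which is the whole chart: `V(g)` has no VERTICAL component), **`ϖ·y ∈ (g) ⇒ y ∈ (g)` in `B`**, and
  `mem_span_of_uniformizer_mul_mem_localization` — the same in every localisation `S` of `B` (the local rings of the blow-up
  at the points of `D₊(xᵢ)`; F3a's `mem_map_of_mul_mem_localization`);
* STRICT TRANSFORM: `blowupAlgebraMap_strictTransform_ne_zero` — for `G = Φ(x) + Ψ = tᵈ·g₁` with `G ∉ ϖA` (the hypersurface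
  `V(G)` has no vertical component) the reduction `θ(g₁) = ḡ₁` is non-zero; hence
  **`mem_span_strictTransform_of_uniformizer_mul_mem[_localization]`**: `ϖ` is a nonzerodivisor modulo the strict-transform
  generator `g₁` on the chart and in all its localisations — with `moduleFlat_of_forall_smul_eq_zero` /
  `ringHomFlat_of_forall_mul_eq_zero` this is «`St_s V(G̃) → Spec O` is FLAT at every point of the chart», `H`-independent and
  WITHOUT any equimultiplicity hypothesis (flatness of the strict transform of an `O`-flat hypersurface is automatic; what
  equimultiplicity buys is the EXACT special fibre, T-M1-EXACT p515745, and regularity transfer).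

HYPOTHESES, all visibly necessary: `ϖ` a nonzerodivisor of `A` (else nothing is flat), `x` quasi-regular with `A/I` a domain and
`ϖ ∉ I` (kernel of `θ`), `A/ϖ` a domain with `xᵢ ∉ ϖA` (so that `ϖB` is prime; in the application `A/ϖ = 𝒪_{P_k,x}` is a regular
local ring and `x̄` is a regular system of parameters), `G ∉ ϖA`.

References: R. Hartshorne, *Algebraic Geometry* (1977), III Prop. 9.7 (flat over a regular one-dimensional base = torsion
free); The Stacks Project, Tags 0539 (flatness over a valuation ring / PID and torsion), 080C (strict transform);
U. Görtz, T. Wedhorn, *Algebraic Geometry I* (2020), (13.19), Prop. 13.96 (2) p. 416 (the reduction map of blow-up algebras).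
Tree inputs: `…NatEquimultipleStrictTransform` (p515745, res-L1-w45b-stub-3), `…NatDoubledConeSaturation` (p510548),
`…NatCarrierDeltaFlat` (p512232, F3a of res-type-100: `mem_map_of_mul_mem_localization`), `AffineBlowupAlgebra`, `BlowupStrictTransform`.
-/

set_option linter.dupNamespace false -- mandated namespace `Summit.<Summit>.<Problem>` of this single-conjunct summit

noncomputable section

namespace Summit.ResolutionOfSingularities.ResolutionOfSingularities.Cruxes.EquisingularLiftNat.Sections

open MvPolynomial IsLocalization IsLocalRing Literature.AlgebraicGeometry.Resolution

universe u

/-! ## Core: a prime nonzerodivisor is a nonzerodivisor modulo anything outside it -/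

section Core

variable {R : Type*} [CommRing R]

/-- **Core of T-M1-FLAT.** If `ϖ` is a nonzerodivisor of `R`, the ideal `(ϖ)` is prime, and `g ∉ (ϖ)`, then `ϖ` is a
nonzerodivisor modulo `g`: `ϖ·a ∈ (g) ⇒ a ∈ (g)`. (Write `ϖa = bg`; then `bg ∈ (ϖ)` forces `b = b′ϖ`, and cancelling `ϖ`
gives `a = b′g`.) [folklore] -/
theorem mem_span_singleton_of_mul_mem_of_isPrime {ϖ g : R} (hϖ : ϖ ∈ nonZeroDivisors R)
    (hp : (Ideal.span ({ϖ} : Set R)).IsPrime) (hg : g ∉ Ideal.span ({ϖ} : Set R)) {a : R}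
    (ha : ϖ * a ∈ Ideal.span ({g} : Set R)) : a ∈ Ideal.span ({g} : Set R) := by
  obtain ⟨b, hb⟩ := Ideal.mem_span_singleton'.mp ha
  -- `b g ∈ (ϖ)`, so `b ∈ (ϖ)`
  have hbg : b * g ∈ Ideal.span ({ϖ} : Set R) := Ideal.mem_span_singleton'.mpr ⟨a, by rw [hb, mul_comm]⟩
  rcases hp.mem_or_mem hbg with hbϖ | hgϖ
  · obtain ⟨b', hb'⟩ := Ideal.mem_span_singleton'.mp hbϖ
    refine Ideal.mem_span_singleton'.mpr ⟨b', ?_⟩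
    apply (mul_cancel_left_mem_nonZeroDivisors hϖ).mp
    calc ϖ * (b' * g) = b' * ϖ * g := by ring
      _ = b * g := by rw [hb']
      _ = ϖ * a := hb
  · exact absurd hgϖ hg

/-- The same, as the statement «`ϖ` is `R/(g)`-regular»: `ϖ·ā = 0` in `R/(g)` implies `ā = 0`. [folklore] -/
theorem quotient_mk_eq_zero_of_mul_eq_zero_of_isPrime {ϖ g : R} (hϖ : ϖ ∈ nonZeroDivisors R)
    (hp : (Ideal.span ({ϖ} : Set R)).IsPrime) (hg : g ∉ Ideal.span ({ϖ} : Set R))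
    {a : R ⧸ Ideal.span ({g} : Set R)} (ha : Ideal.Quotient.mk (Ideal.span ({g} : Set R)) ϖ * a = 0) : a = 0 := by
  obtain ⟨a, rfl⟩ := Ideal.Quotient.mk_surjective a
  rw [← map_mul, Ideal.Quotient.eq_zero_iff_mem] at ha
  exact Ideal.Quotient.eq_zero_iff_mem.mpr (mem_span_singleton_of_mul_mem_of_isPrime hϖ hp hg ha)

end Core

/-! ## Over a discrete valuation ring: uniformizer-torsion-free modules are flat -/

section DVR

variable {O : Type*} [CommRing O] [IsDomain O] [IsDiscreteValuationRing O]

/-- **Over a DVR, a module on which the uniformizer acts injectively is flat** (Hartshorne III 9.7 / Stacks 0539: over a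
principal ideal domain flat = torsion-free, and every non-zero element of `O` is `u·ϖⁿ` with `u` a unit).
[cite: Hartshorne1977, III Prop. 9.7 p. 257] -/
theorem moduleFlat_of_forall_smul_eq_zero {ϖ : O} (hϖ : Irreducible ϖ) {M : Type*} [AddCommGroup M] [Module O M]
    (h : ∀ m : M, ϖ • m = 0 → m = 0) : Module.Flat O M := by
  rw [Module.Flat.flat_iff_torsion_eq_bot_of_isBezout, ← Submodule.isTorsionFree_iff_torsion_eq_bot]
  refine ⟨fun ρ hρ => ?_⟩
  rw [isSMulRegular_iff_right_eq_zero_of_smul]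
  intro m hm
  obtain ⟨n, u, hu⟩ := IsDiscreteValuationRing.eq_unit_mul_pow_irreducible hρ.ne_zero hϖ
  rw [hu, mul_smul] at hm
  have hm' : ϖ ^ n • m = 0 := by
    have := congrArg (fun z => ((u⁻¹ : Oˣ) : O) • z) hm
    simpa [smul_smul] using this
  clear hm hu
  induction n generalizing m with
  | zero => simpa using hm'
  | succ n ih =>
    rw [pow_succ, mul_smul] at hm'
    exact h m (ih _ hm')

/-- **Ring-map form**: a ring map `f : O → T` from a DVR such that `f(ϖ)` is a nonzerodivisor of `T` is flat.
[cite: Hartshorne1977, III Prop. 9.7 p. 257] -/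
theorem ringHomFlat_of_forall_mul_eq_zero {ϖ : O} (hϖ : Irreducible ϖ) {T : Type*} [CommRing T] (f : O →+* T)
    (h : ∀ t : T, f ϖ * t = 0 → t = 0) : f.Flat := by
  algebraize [f]
  exact moduleFlat_of_forall_smul_eq_zero hϖ (M := T) fun t ht => h t (by rwa [Algebra.smul_def] at ht)

end DVR

/-! ## The chart `B = A[I/xᵢ]` and the reduction map `θ : B → B̄ = Ā[Ī/x̄ᵢ]` -/

section Chart

variable {A : Type u} [CommRing A] {r : ℕ} (x : Fin r → A) (i : Fin r) (ϖ : A)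

/-- A nonzerodivisor of `A` stays a nonzerodivisor in the chart `A[I/xᵢ] ⊆ A[1/xᵢ]`. [folklore] -/
theorem algebraMap_mem_nonZeroDivisors_blowupAlgebra_of_mem {a : A} (ha : a ∈ nonZeroDivisors A) :
    algebraMap A (blowupAlgebra (Ideal.span (Set.range x)) (x i)) a ∈
      nonZeroDivisors (blowupAlgebra (Ideal.span (Set.range x)) (x i)) := by
  refine mem_nonZeroDivisors_of_injective (f := (blowupAlgebra (Ideal.span (Set.range x)) (x i)).val)
    Subtype.val_injective ?_
  exact IsLocalization.nonZeroDivisors_le_comap (Submonoid.powers (x i)) (Localization.Away (x i)) ha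

/-- `θ(ϖ/1) = ϖ̄/1 = 0`. [folklore] -/
theorem blowupAlgebraMap_algebraMap_uniformizer :
    blowupAlgebraMap (Ideal.Quotient.mk (Ideal.span {ϖ})) (Ideal.span (Set.range x))
        (Ideal.span (Set.range fun l => Ideal.Quotient.mk (Ideal.span {ϖ}) (x l))) (x i)
        (map_span_range_le_span_range_mk x ϖ)
        (algebraMap A (blowupAlgebra (Ideal.span (Set.range x)) (x i)) ϖ) = 0 := by
  rw [blowupAlgebraMap_algebraMap, Ideal.Quotient.eq_zero_iff_mem.mpr (Ideal.mem_span_singleton_self ϖ), map_zero]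

/-- If the reduction `θ g` is non-zero then `g ∉ ϖ·A[I/xᵢ]`. [folklore] -/
theorem notMem_span_uniformizer_of_blowupAlgebraMap_ne_zero
    (g : blowupAlgebra (Ideal.span (Set.range x)) (x i))
    (hg : blowupAlgebraMap (Ideal.Quotient.mk (Ideal.span {ϖ})) (Ideal.span (Set.range x))
        (Ideal.span (Set.range fun l => Ideal.Quotient.mk (Ideal.span {ϖ}) (x l))) (x i)
        (map_span_range_le_span_range_mk x ϖ) g ≠ 0) :
    g ∉ Ideal.span {algebraMap A (blowupAlgebra (Ideal.span (Set.range x)) (x i)) ϖ} := by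
  intro hmem
  apply hg
  obtain ⟨b, rfl⟩ := Ideal.mem_span_singleton'.mp hmem
  rw [map_mul, blowupAlgebraMap_algebraMap_uniformizer, mul_zero]

/-- The downstairs chart `B̄ = Ā[Ī/x̄ᵢ] ⊆ Ā[1/x̄ᵢ]` is a domain when `Ā = A/ϖ` is a domain and `xᵢ ∉ ϖA`. [folklore] -/
theorem isDomain_blowupAlgebra_reduction [IsDomain (A ⧸ Ideal.span ({ϖ} : Set A))]
    (hxi : x i ∉ Ideal.span ({ϖ} : Set A)) :
    IsDomain (blowupAlgebra (Ideal.span (Set.range fun l => Ideal.Quotient.mk (Ideal.span {ϖ}) (x l)))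
      (Ideal.Quotient.mk (Ideal.span {ϖ}) (x i))) := by
  have hx0 : Ideal.Quotient.mk (Ideal.span {ϖ}) (x i) ≠ 0 := by
    rwa [Ne, Ideal.Quotient.eq_zero_iff_mem]
  haveI : IsDomain (Localization.Away (Ideal.Quotient.mk (Ideal.span {ϖ}) (x i))) :=
    IsLocalization.isDomain_localization (powers_le_nonZeroDivisors_of_noZeroDivisors hx0)
  exact Subalgebra.isDomain _

/-- The structure map `Ā → B̄ = Ā[Ī/x̄ᵢ]` is injective when `Ā = A/ϖ` is a domain and `xᵢ ∉ ϖA`. [folklore] -/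
theorem algebraMap_blowupAlgebra_reduction_injective [IsDomain (A ⧸ Ideal.span ({ϖ} : Set A))]
    (hxi : x i ∉ Ideal.span ({ϖ} : Set A)) :
    Function.Injective (algebraMap (A ⧸ Ideal.span {ϖ})
      (blowupAlgebra (Ideal.span (Set.range fun l => Ideal.Quotient.mk (Ideal.span {ϖ}) (x l)))
        (Ideal.Quotient.mk (Ideal.span {ϖ}) (x i)))) := by
  have hx0 : Ideal.Quotient.mk (Ideal.span {ϖ}) (x i) ≠ 0 := by
    rwa [Ne, Ideal.Quotient.eq_zero_iff_mem]
  intro a b hab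
  have hab' := congrArg (Subtype.val : blowupAlgebra _ _ → Localization.Away (Ideal.Quotient.mk (Ideal.span {ϖ}) (x i))) hab
  exact IsLocalization.injective (Localization.Away (Ideal.Quotient.mk (Ideal.span {ϖ}) (x i)))
    (powers_le_nonZeroDivisors_of_noZeroDivisors hx0) hab'

/-- **`ϖ·A[I/xᵢ]` is a PRIME ideal** (`x` quasi-regular, `A/I` a domain, `ϖ ∉ I`, `A/ϖ` a domain, `xᵢ ∉ ϖA`): it is the kernel of
the reduction map `θ` onto the domain `B̄`. [cite: GortzWedhorn2020, Prop. 13.96 (2) (proof), p. 416] -/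
theorem isPrime_span_algebraMap_uniformizer (hx : IsQuasiRegular x) [IsDomain (A ⧸ Ideal.span (Set.range x))]
    (hϖ : ϖ ∉ Ideal.span (Set.range x)) [IsDomain (A ⧸ Ideal.span ({ϖ} : Set A))]
    (hxi : x i ∉ Ideal.span ({ϖ} : Set A)) :
    (Ideal.span {algebraMap A (blowupAlgebra (Ideal.span (Set.range x)) (x i)) ϖ}).IsPrime := by
  haveI := isDomain_blowupAlgebra_reduction x i ϖ hxi
  have hker := ker_blowupAlgebraMap_quotient_uniformizer x i hx hϖ
    (Ideal.span (Set.range fun l => Ideal.Quotient.mk (Ideal.span {ϖ}) (x l))) (map_span_range_le_span_range_mk x ϖ)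
  rw [Ideal.map_span, Set.image_singleton] at hker
  rw [← hker]
  exact RingHom.ker_isPrime _

/-- **T-M1-FLAT on the chart.** Let `ϖ` be a nonzerodivisor of `A`, `x` quasi-regular with `A/I` a domain and `ϖ ∉ I`, and
`A/ϖ` a domain with `xᵢ ∉ ϖA`. Then for every `g ∈ B = A[I/xᵢ]` whose reduction `θ g ∈ B̄` is NON-ZERO (no vertical component),
**`ϖ` is a nonzerodivisor modulo `g`: `ϖ·y ∈ (g) ⇒ y ∈ (g)`** — `B/(g)` is `ϖ`-torsion-free, i.e. FLAT over the discrete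
valuation ring (`moduleFlat_of_forall_smul_eq_zero`). [cite: Hartshorne1977, III Prop. 9.7 p. 257]
[OURS · L1 W4.5b] T-M1-FLAT (res-L1-w45b-lead-2 DESIGN v6 (TC⁺), clause «O-flat» of the proximity-lift centre) toward the
registered stubs of `EquisingularLiftNat(Three)` (stmt-ResolutionOfSingularities-20038 / -20148); NOT a statement of the manuscript. -/
theorem mem_span_of_uniformizer_mul_mem (hϖA : ϖ ∈ nonZeroDivisors A) (hx : IsQuasiRegular x)
    [IsDomain (A ⧸ Ideal.span (Set.range x))] (hϖ : ϖ ∉ Ideal.span (Set.range x))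
    [IsDomain (A ⧸ Ideal.span ({ϖ} : Set A))] (hxi : x i ∉ Ideal.span ({ϖ} : Set A))
    (g : blowupAlgebra (Ideal.span (Set.range x)) (x i))
    (hg : blowupAlgebraMap (Ideal.Quotient.mk (Ideal.span {ϖ})) (Ideal.span (Set.range x))
        (Ideal.span (Set.range fun l => Ideal.Quotient.mk (Ideal.span {ϖ}) (x l))) (x i)
        (map_span_range_le_span_range_mk x ϖ) g ≠ 0)
    (y : blowupAlgebra (Ideal.span (Set.range x)) (x i))
    (hy : algebraMap A (blowupAlgebra (Ideal.span (Set.range x)) (x i)) ϖ * y ∈ Ideal.span {g}) :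
    y ∈ Ideal.span {g} :=
  mem_span_singleton_of_mul_mem_of_isPrime (algebraMap_mem_nonZeroDivisors_blowupAlgebra_of_mem x i hϖA)
    (isPrime_span_algebraMap_uniformizer x i ϖ hx hϖ hxi)
    (notMem_span_uniformizer_of_blowupAlgebraMap_ne_zero x i ϖ g hg) hy

/-- **T-M1-FLAT in stalk currency**: the same in every localisation `S` of the chart `B = A[I/xᵢ]` (the local rings of the
blow-up at the points of `D₊(xᵢ)`): `ϖ·y ∈ (g)S ⇒ y ∈ (g)S`. [cite: Hartshorne1977, III Prop. 9.7 p. 257] -/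
theorem mem_span_of_uniformizer_mul_mem_localization (hϖA : ϖ ∈ nonZeroDivisors A) (hx : IsQuasiRegular x)
    [IsDomain (A ⧸ Ideal.span (Set.range x))] (hϖ : ϖ ∉ Ideal.span (Set.range x))
    [IsDomain (A ⧸ Ideal.span ({ϖ} : Set A))] (hxi : x i ∉ Ideal.span ({ϖ} : Set A))
    (g : blowupAlgebra (Ideal.span (Set.range x)) (x i))
    (hg : blowupAlgebraMap (Ideal.Quotient.mk (Ideal.span {ϖ})) (Ideal.span (Set.range x))
        (Ideal.span (Set.range fun l => Ideal.Quotient.mk (Ideal.span {ϖ}) (x l))) (x i)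
        (map_span_range_le_span_range_mk x ϖ) g ≠ 0)
    (M : Submonoid (blowupAlgebra (Ideal.span (Set.range x)) (x i))) (S : Type*) [CommRing S]
    [Algebra (blowupAlgebra (Ideal.span (Set.range x)) (x i)) S] [IsLocalization M S] (y : S)
    (hy : algebraMap (blowupAlgebra (Ideal.span (Set.range x)) (x i)) S
        (algebraMap A (blowupAlgebra (Ideal.span (Set.range x)) (x i)) ϖ) * y ∈
      Ideal.span {algebraMap (blowupAlgebra (Ideal.span (Set.range x)) (x i)) S g}) :
    y ∈ Ideal.span {algebraMap (blowupAlgebra (Ideal.span (Set.range x)) (x i)) S g} := by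
  have hmap : (Ideal.span {g}).map (algebraMap (blowupAlgebra (Ideal.span (Set.range x)) (x i)) S) =
      Ideal.span {algebraMap (blowupAlgebra (Ideal.span (Set.range x)) (x i)) S g} := by
    rw [Ideal.map_span, Set.image_singleton]
  rw [← hmap] at hy ⊢
  exact mem_map_of_mul_mem_localization M S (mem_span_of_uniformizer_mul_mem x i ϖ hϖA hx hϖ hxi g hg) y hy

/-! ## The strict transform `g₁` of `G = Φ(x) + Ψ = tᵈ g₁` -/

/-- **No vertical component transfers to the strict transform**: if `G ∉ ϖA` (with `A/ϖ` a domain, `xᵢ ∉ ϖA`) and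
`G = tᵈ·g₁` on the chart, then the reduction `θ(g₁) = ḡ₁` is non-zero — since `Ḡ/1 = t̄ᵈ·ḡ₁` in the domain `B̄ ⊇ Ā`.
[folklore] -/
theorem blowupAlgebraMap_strictTransform_ne_zero [IsDomain (A ⧸ Ideal.span ({ϖ} : Set A))]
    (hxi : x i ∉ Ideal.span ({ϖ} : Set A)) {d : ℕ} (Φ : MvPolynomial (Fin r) A)
    (ψ : blowupAlgebra (Ideal.span (Set.range x)) (x i)) {G : A} (hGϖ : G ∉ Ideal.span ({ϖ} : Set A))
    (hG : algebraMap A (blowupAlgebra (Ideal.span (Set.range x)) (x i)) G =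
      algebraMap A (blowupAlgebra (Ideal.span (Set.range x)) (x i)) (x i) ^ d *
        (MvPolynomial.aeval (blowupAlgebra.frac x i) Φ +
          algebraMap A (blowupAlgebra (Ideal.span (Set.range x)) (x i)) (x i) * ψ)) :
    blowupAlgebraMap (Ideal.Quotient.mk (Ideal.span {ϖ})) (Ideal.span (Set.range x))
        (Ideal.span (Set.range fun l => Ideal.Quotient.mk (Ideal.span {ϖ}) (x l))) (x i)
        (map_span_range_le_span_range_mk x ϖ)
        (MvPolynomial.aeval (blowupAlgebra.frac x i) Φ +
          algebraMap A (blowupAlgebra (Ideal.span (Set.range x)) (x i)) (x i) * ψ) ≠ 0 := by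
  intro h0
  have hred := algebraMap_mk_tangentCone_eq x i ϖ Φ ψ hG
  rw [blowupAlgebraMap_strictTransform] at h0
  rw [h0, mul_zero] at hred
  have hinj := algebraMap_blowupAlgebra_reduction_injective x i ϖ hxi
  have hG0 : Ideal.Quotient.mk (Ideal.span {ϖ}) G = 0 := hinj (by rw [hred, map_zero])
  exact hGϖ (Ideal.Quotient.eq_zero_iff_mem.mp hG0)

/-- **T-M1-FLAT for the strict transform (chart).** `ϖ` a nonzerodivisor of `A`, `x` quasi-regular, `A/I` a domain, `ϖ ∉ I`,
`A/ϖ` a domain, `xᵢ ∉ ϖA`, and `G = Φ(x) + Ψ = tᵈ·g₁ ∉ ϖA` (the hypersurface `V(G)` is flat over the DVR): then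
**`ϖ·y ∈ (g₁) ⇒ y ∈ (g₁)`** on `A[I/xᵢ]` — the strict transform `V(g₁) = St_s V(G)` of the hypersurface along the section is
FLAT over the discrete valuation ring on the chart. No equimultiplicity is needed for flatness (equimultiplicity is what makes
the special fibre EXACT, `map_blowupAlgebraMap_strictTransformIdeal_eq`). [cite: Hartshorne1977, III Prop. 9.7 p. 257]
[OURS · L1 W4.5b] T-M1-FLAT; NOT a statement of the manuscript. -/
theorem mem_span_strictTransform_of_uniformizer_mul_mem (hϖA : ϖ ∈ nonZeroDivisors A) (hx : IsQuasiRegular x)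
    [IsDomain (A ⧸ Ideal.span (Set.range x))] (hϖ : ϖ ∉ Ideal.span (Set.range x))
    [IsDomain (A ⧸ Ideal.span ({ϖ} : Set A))] (hxi : x i ∉ Ideal.span ({ϖ} : Set A))
    {d : ℕ} (Φ : MvPolynomial (Fin r) A) (ψ : blowupAlgebra (Ideal.span (Set.range x)) (x i)) {G : A}
    (hGϖ : G ∉ Ideal.span ({ϖ} : Set A))
    (hG : algebraMap A (blowupAlgebra (Ideal.span (Set.range x)) (x i)) G =
      algebraMap A (blowupAlgebra (Ideal.span (Set.range x)) (x i)) (x i) ^ d *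
        (MvPolynomial.aeval (blowupAlgebra.frac x i) Φ +
          algebraMap A (blowupAlgebra (Ideal.span (Set.range x)) (x i)) (x i) * ψ))
    (y : blowupAlgebra (Ideal.span (Set.range x)) (x i))
    (hy : algebraMap A (blowupAlgebra (Ideal.span (Set.range x)) (x i)) ϖ * y ∈
      Ideal.span {MvPolynomial.aeval (blowupAlgebra.frac x i) Φ +
        algebraMap A (blowupAlgebra (Ideal.span (Set.range x)) (x i)) (x i) * ψ}) :
    y ∈ Ideal.span {MvPolynomial.aeval (blowupAlgebra.frac x i) Φ +
      algebraMap A (blowupAlgebra (Ideal.span (Set.range x)) (x i)) (x i) * ψ} :=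
  mem_span_of_uniformizer_mul_mem x i ϖ hϖA hx hϖ hxi _
    (blowupAlgebraMap_strictTransform_ne_zero x i ϖ hxi Φ ψ hGϖ hG) y hy

/-- **T-M1-FLAT for the strict transform, stalk currency**: in every localisation `S` of the chart,
`ϖ·y ∈ (g₁)S ⇒ y ∈ (g₁)S`. With `ringHomFlat_of_forall_mul_eq_zero` applied to `O → S/(g₁)` this is the clause «`C → Spec O`
flat» of a HorizChainE1 step for the proximity-lift centre `C = St_s V(G̃)`, at the points of `D₊(xᵢ)`.
[cite: Hartshorne1977, III Prop. 9.7 p. 257] [OURS · L1 W4.5b] T-M1-FLAT; NOT a statement of the manuscript. -/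
theorem mem_span_strictTransform_of_uniformizer_mul_mem_localization (hϖA : ϖ ∈ nonZeroDivisors A)
    (hx : IsQuasiRegular x) [IsDomain (A ⧸ Ideal.span (Set.range x))] (hϖ : ϖ ∉ Ideal.span (Set.range x))
    [IsDomain (A ⧸ Ideal.span ({ϖ} : Set A))] (hxi : x i ∉ Ideal.span ({ϖ} : Set A))
    {d : ℕ} (Φ : MvPolynomial (Fin r) A) (ψ : blowupAlgebra (Ideal.span (Set.range x)) (x i)) {G : A}
    (hGϖ : G ∉ Ideal.span ({ϖ} : Set A))
    (hG : algebraMap A (blowupAlgebra (Ideal.span (Set.range x)) (x i)) G =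
      algebraMap A (blowupAlgebra (Ideal.span (Set.range x)) (x i)) (x i) ^ d *
        (MvPolynomial.aeval (blowupAlgebra.frac x i) Φ +
          algebraMap A (blowupAlgebra (Ideal.span (Set.range x)) (x i)) (x i) * ψ))
    (M : Submonoid (blowupAlgebra (Ideal.span (Set.range x)) (x i))) (S : Type*) [CommRing S]
    [Algebra (blowupAlgebra (Ideal.span (Set.range x)) (x i)) S] [IsLocalization M S] (y : S)
    (hy : algebraMap (blowupAlgebra (Ideal.span (Set.range x)) (x i)) S
        (algebraMap A (blowupAlgebra (Ideal.span (Set.range x)) (x i)) ϖ) * y ∈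
      Ideal.span {algebraMap (blowupAlgebra (Ideal.span (Set.range x)) (x i)) S
        (MvPolynomial.aeval (blowupAlgebra.frac x i) Φ +
          algebraMap A (blowupAlgebra (Ideal.span (Set.range x)) (x i)) (x i) * ψ)}) :
    y ∈ Ideal.span {algebraMap (blowupAlgebra (Ideal.span (Set.range x)) (x i)) S
      (MvPolynomial.aeval (blowupAlgebra.frac x i) Φ +
        algebraMap A (blowupAlgebra (Ideal.span (Set.range x)) (x i)) (x i) * ψ)} :=
  mem_span_of_uniformizer_mul_mem_localization x i ϖ hϖA hx hϖ hxi _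
    (blowupAlgebraMap_strictTransform_ne_zero x i ϖ hxi Φ ψ hGϖ hG) M S y hy

/-- **The quotient form**: under the same hypotheses, for `S` a localisation of the chart and `𝔞 = (g₁)S`, the element `ϖ`
acts injectively on `S/𝔞`: `ϖ·z = 0 ⇒ z = 0`. Feed this to `moduleFlat_of_forall_smul_eq_zero` /
`ringHomFlat_of_forall_mul_eq_zero` (with `ϖ` the image of the uniformizer of `O`) to get `Module.Flat O (S/𝔞)`.
[cite: Hartshorne1977, III Prop. 9.7 p. 257] [OURS · L1 W4.5b] T-M1-FLAT; NOT a statement of the manuscript. -/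
theorem quotient_strictTransform_eq_zero_of_uniformizer_mul_eq_zero (hϖA : ϖ ∈ nonZeroDivisors A)
    (hx : IsQuasiRegular x) [IsDomain (A ⧸ Ideal.span (Set.range x))] (hϖ : ϖ ∉ Ideal.span (Set.range x))
    [IsDomain (A ⧸ Ideal.span ({ϖ} : Set A))] (hxi : x i ∉ Ideal.span ({ϖ} : Set A))
    {d : ℕ} (Φ : MvPolynomial (Fin r) A) (ψ : blowupAlgebra (Ideal.span (Set.range x)) (x i)) {G : A}
    (hGϖ : G ∉ Ideal.span ({ϖ} : Set A))
    (hG : algebraMap A (blowupAlgebra (Ideal.span (Set.range x)) (x i)) G =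
      algebraMap A (blowupAlgebra (Ideal.span (Set.range x)) (x i)) (x i) ^ d *
        (MvPolynomial.aeval (blowupAlgebra.frac x i) Φ +
          algebraMap A (blowupAlgebra (Ideal.span (Set.range x)) (x i)) (x i) * ψ))
    (M : Submonoid (blowupAlgebra (Ideal.span (Set.range x)) (x i))) (S : Type*) [CommRing S]
    [Algebra (blowupAlgebra (Ideal.span (Set.range x)) (x i)) S] [IsLocalization M S]
    (z : S ⧸ Ideal.span {algebraMap (blowupAlgebra (Ideal.span (Set.range x)) (x i)) S
      (MvPolynomial.aeval (blowupAlgebra.frac x i) Φ +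
        algebraMap A (blowupAlgebra (Ideal.span (Set.range x)) (x i)) (x i) * ψ)})
    (hz : Ideal.Quotient.mk _ (algebraMap (blowupAlgebra (Ideal.span (Set.range x)) (x i)) S
        (algebraMap A (blowupAlgebra (Ideal.span (Set.range x)) (x i)) ϖ)) * z = 0) : z = 0 := by
  obtain ⟨y, rfl⟩ := Ideal.Quotient.mk_surjective z
  rw [← map_mul, Ideal.Quotient.eq_zero_iff_mem] at hz
  exact Ideal.Quotient.eq_zero_iff_mem.mpr
    (mem_span_strictTransform_of_uniformizer_mul_mem_localization x i ϖ hϖA hx hϖ hxi Φ ψ hGϖ hG M S y hz)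

end Chart

end Summit.ResolutionOfSingularities.ResolutionOfSingularities.Cruxes.EquisingularLiftNat.Sections

end
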